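import Literature.NumberTheory.EllipticCurves.Kato2004.DefinedExpStarBodyIsogenyTransport
import Literature.NumberTheory.EllipticCurves.DokchitserDokchitser2015.PadicLogIsogenyInvariance
import HarnessLib

/-!
# The Néron / Tate-duality NORMALISATION clause (A2) of Kato's realised family is TRANSPORTED along a `ℚ`-isogeny pair of
# exponent prime to `p` — kernel theorem, modulo the cited dual-log-lattice fact (T-A2)′

`Proofs`-style companion of `Kato2004/DefinedExpStarBodyIsogenyTransport.lean` (p825173) — THEOREMS ONLY: no definition, no named fact, no
instance, no notation, no `sorry`.  Seat `bsd-cm-k-ty1` g36 (literature-prover, cell `bsd-cm`), step (2) «kernel transport (M)» of the road of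
record for crux `EllipticUnitValueSevenOfGZK` = stmt-BirchSwinnertonDyer-19945 (pen bsd-cm-plan g39 D1166 (5″)/D1167, brief
`bsd-cm-plan/WAKE-P1-FP1-EXACT.md` v3.2; critic idea-crit-15 NOTE #35 (2), NOTE #36).

WHAT p825173 LEFT OPEN (its module docstring, «What this does NOT transport»): the clause (A2) of `AdmissibleZetaClassBody` / of the letter
of record `CM.kato15161_ellipticUnitClass_res_zetaFamily_exact` (p827705, l.263–267),
`∀ a, (∃ η, exp*_d(η) = a) ↔ ∀ Q ∈ W(ℚ_p), ‖a · log_ω(Q)‖ ≤ 1` — «the image of `exp*_d` on `H¹(ℚ_p, T_pW)` is the `ℤ_p`-dual of the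
log-lattice `𝓛_W = log_ω(W(ℚ_p))` of the minimal model» — because its right-hand side is the formal logarithm of `W`'s OWN minimal model.
WHAT IS PROVED HERE (`neronClause_isogeny_transport`): for globally minimal elliptic `W, W₂ / ℚ`, a `ℚ`-isogeny pair `β : W → W₂`, `α : W₂ → W`
with `α ∘ β = [e]` AND `β ∘ α = [e]`, a prime `p ∤ e`, generators `d`, `d₂` related by p825173 (i)
(`exp*_{d₂}(η) = e⁻¹ · exp*_d(α_* η)`), and the cited fact (T-A2)′
`DokchitserDokchitser2015.padicLogLocal_dual_eq_of_isogenyPair_coprime` (p827831: `𝓛_W^∨ = 𝓛_{W₂}^∨` in `ℚ_p`) as a HYPOTHESIS: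
(A2) at `(W, d)` implies (A2) at `(W₂, d₂)` — LETTER FOR LETTER the clause of p827705 l.263–267 read with `W ↦ W₂`, `d ↦ d₂`, `ρT ↦ ρT₂`.
PROOF (kernel, ≈ 40 lines): `⊆`: `exp*_{d₂}(η₂) = a` ⇒ `exp*_d(α_* η₂) = e·a` ⇒ ((A2)@W) `e·a ∈ 𝓛_W^∨` ⇒ (`|e|_p = 1`) `a ∈ 𝓛_W^∨ = 𝓛_{W₂}^∨`;
`⊇`: `a ∈ 𝓛_{W₂}^∨ = 𝓛_W^∨` ⇒ `e·a ∈ 𝓛_W^∨` ⇒ ((A2)@W) `exp*_d(η) = e·a` for some cocycle `η` of `T_pW`; since `p ∤ e`, `T_pα` is INVERTIBLE with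
inverse `e⁻¹·T_pβ` (`T_pα ∘ T_pβ = e`, `e ∈ ℤ_pˣ`), so `η₂ := (e⁻¹·T_pβ)_* η` is a continuous cocycle of `T_pW₂` with `α_* η₂ = η`, whence
`exp*_{d₂}(η₂) = e⁻¹ · e·a = a`.  NO additivity of `exp*` is used (the tree's `dualExpCoord_add` needs `CupLogInjective`), no `HasDualExp`,
no `p`-adic Hodge input: the only analytic content is the cited (T-A2)′.

HONEST FRAMING: a kernel fact about the tree's own definitions, CONDITIONAL on the named fact (T-A2)′ (hypothesis `hT`, not discharged
here); nothing about zeta values, Kato's theorems or BSD is proved; no summit statement is touched; 19945 stays OPEN.  Consumer: (K-2★)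
feeds `CM.kato15161_ellipticUnitClass_res_zetaFamily_exact′` at the partner `W₂` of a `𝒞₇` member with the (A1) ∧ (A2) datum
`⟨d₂, p825173 (ii), THIS⟩`.

## References
* T. Dokchitser, V. Dokchitser, *Local invariants of isogenous elliptic curves*, Trans. AMS 367 (2015), §4 Lemma 10, Lemma 11. [DokchitserDokchitser2015LocalInvariants]
* K. Kato, LNM 1553 (1993), Ch. II §1.2.4 and Ex. 1.3.5 (naturality of `exp*`). [Kato1993LNM1553]
* S. Bloch, K. Kato (1990), Def. 3.10, Ex. 3.10.1 and Example 3.11 (p. 361) (`exp*` and the log-lattice of `E(ℚ_p)`). [BlochKato1990]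
* K. Kato, Astérisque 295 (2004), Ex. 13.3 (pp. 224–225), Thm. 12.5 (1) (p. 221). [Kato2004Asterisque]
* J. H. Silverman, *AEC* (2009), Thm. III.6.1 (a), III.7.4. [SilvermanAEC2009]
* Tree: `Kato2004/DefinedExpStarBodyIsogenyTransport.lean` (p825173: `definedExpStarBody_isogeny_transport`, `expStarCoord_map_symm`),
  `DokchitserDokchitser2015/PadicLogIsogenyInvariance.lean` (p827831), `Kato2004/EllipticUnitZetaClassComparisonExact.lean` (p827705, clause (A2)),
  `Kato2004/IwasawaH1Reduction.lean` (`contOneCocycles.pushAddHom`), `Kato2004/EulerSystemIsogenyTransport.lean` (`continuous_tateModule_map`).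
-/

noncomputable section

open scoped BigOperators NumberField TensorProduct Pointwise
open Polynomial Field IsDedekindDomain NumberField CongruenceSubgroup ValuativeRel
open Literature.NumberTheory.GaloisRepresentations
open Literature.NumberTheory.GaloisRepresentations.PeriodRingData
open Literature.NumberTheory.GaloisRepresentations.IsNonarchimedeanLocalField
open Literature.NumberTheory.PAdicHodge
open Literature.NumberTheory.EllipticCurves Literature.NumberTheory.EllipticCurves.ModularForms
open Literature.NumberTheory.AdelicBaseChange Literature.NumberTheory.Automorphic
open WeierstrassCurve (Isogeny)

namespace Literature.NumberTheory.EllipticCurves.Kato2004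

open EulerSystemValues Rat.HeightOneSpectrum

section Transport

set_option backward.isDefEq.respectTransparency false in
/-- ★ **The Néron / Tate-duality normalisation clause (A2) moves along a `ℚ`-isogeny pair of exponent prime to `p`** (modulo the cited
dual-log-lattice fact (T-A2)′).  Let `W, W₂ / ℚ` be globally minimal elliptic curves, `β : W → W₂`, `α : W₂ → W` `ℚ`-isogenies with
`α ∘ β = [e]` on `W(ℚ̄)` and `β ∘ α = [e]` on `W₂(ℚ̄)`, `p ∤ e`, and let `d`, `d₂` be generators of `D⁰_dR(V_pW|_{Γ_{ℚ_v}})`, `D⁰_dR(V_pW₂|_{Γ_{ℚ_v}})`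
with `exp*_{d₂}(η) = e⁻¹ · exp*_d(η′)` whenever `η′ = T_pα ∘ η` (conclusion (i) of `definedExpStarBody_isogeny_transport`).  If
`∀ a, (∃ η, exp*_d(η) = a) ↔ ∀ Q ∈ W(ℚ_p), ‖a · log_ω Q‖ ≤ 1` ((A2) at `(W, d)`, `a` read in `ℚ_p` through Mathlib's `ℚ_p ≃ ℚ_v`), then
`∀ a, (∃ η₂, exp*_{d₂}(η₂) = a) ↔ ∀ Q₂ ∈ W₂(ℚ_p), ‖a · log_{ω₂} Q₂‖ ≤ 1` ((A2) at `(W₂, d₂)`).  Proof: module docstring (`T_pα` is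
invertible with inverse `e⁻¹ · T_pβ`; `|e|_p = 1`; (T-A2)′ exchanges the two log-lattices); no additivity of `exp*` is used.
[cite: DokchitserDokchitser2015LocalInvariants, §4 Lemma 10 (1)–(2) and Lemma 11] [cite: Kato1993LNM1553, Ch. II §1.2.4 and Ex. 1.3.5]
[cite: BlochKato1990, Def. 3.10 and Example 3.11 (p. 361)] [cite: SilvermanAEC2009, Thm. III.6.1 (a) and III.7.4] -/
theorem neronClause_isogeny_transport (hT : DokchitserDokchitser2015.padicLogLocal_dual_eq_of_isogenyPair_coprime)
    (W W₂ : WeierstrassCurve ℚ) [W.IsElliptic] [W.IsGloballyMinimal] [W₂.IsElliptic] [W₂.IsGloballyMinimal] (p : ℕ) [Fact p.Prime]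
    [ContinuousSMul ℤ_[p] (W.tateModule p)] [ContinuousSMul ℤ_[p] (W₂.tateModule p)]
    (β : Isogeny W W₂) (α : Isogeny W₂ W) {e : ℤ} (hαβ : ∀ P, α (β P) = e • P) (hβα : ∀ Q, β (α Q) = e • Q)
    (hpe : ¬ (p : ℤ) ∣ e) :
    letI : ValuativeRel (NumberField.Place.Completion (Sum.inr ((Rat.HeightOneSpectrum.primesEquiv (R := 𝓞 ℚ)).symm ⟨p, Fact.out⟩) : NumberField.Place ℚ)) :=
      inferInstanceAs (ValuativeRel (((Rat.HeightOneSpectrum.primesEquiv (R := 𝓞 ℚ)).symm ⟨p, Fact.out⟩).adicCompletion ℚ))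
    letI : TopologicalSpace (NumberField.Place.Completion (Sum.inr ((Rat.HeightOneSpectrum.primesEquiv (R := 𝓞 ℚ)).symm ⟨p, Fact.out⟩) : NumberField.Place ℚ)) :=
      inferInstanceAs (TopologicalSpace (((Rat.HeightOneSpectrum.primesEquiv (R := 𝓞 ℚ)).symm ⟨p, Fact.out⟩).adicCompletion ℚ))
    haveI : IsNonarchimedeanLocalField (NumberField.Place.Completion (Sum.inr ((Rat.HeightOneSpectrum.primesEquiv (R := 𝓞 ℚ)).symm ⟨p, Fact.out⟩) : NumberField.Place ℚ)) :=
      inferInstanceAs (IsNonarchimedeanLocalField (((Rat.HeightOneSpectrum.primesEquiv (R := 𝓞 ℚ)).symm ⟨p, Fact.out⟩).adicCompletion ℚ))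
    haveI : CharZero (NumberField.Place.Completion (Sum.inr ((Rat.HeightOneSpectrum.primesEquiv (R := 𝓞 ℚ)).symm ⟨p, Fact.out⟩) : NumberField.Place ℚ)) := LocalField.charZero_adicCompletion ((Rat.HeightOneSpectrum.primesEquiv (R := 𝓞 ℚ)).symm ⟨p, Fact.out⟩)
    letI : Algebra ℚ_[p] (NumberField.Place.Completion (Sum.inr ((Rat.HeightOneSpectrum.primesEquiv (R := 𝓞 ℚ)).symm ⟨p, Fact.out⟩) : NumberField.Place ℚ)) :=
      LocalField.adicCompletionPadicAlgebra ((Rat.HeightOneSpectrum.primesEquiv (R := 𝓞 ℚ)).symm ⟨p, Fact.out⟩) p ((natCast_mem_asIdeal_iff_eq_primesEquiv_symm _ (Fact.out : p.Prime)).mpr rfl)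
    haveI : Fact (¬ IsUnit ((p : ℕ) : integerC (NumberField.Place.Completion (Sum.inr ((Rat.HeightOneSpectrum.primesEquiv (R := 𝓞 ℚ)).symm ⟨p, Fact.out⟩) : NumberField.Place ℚ)))) :=
      ⟨not_isUnit_natCast_integerC (show valuation (NumberField.Place.Completion (Sum.inr ((Rat.HeightOneSpectrum.primesEquiv (R := 𝓞 ℚ)).symm ⟨p, Fact.out⟩) : NumberField.Place ℚ)) ((p : ℕ) : (NumberField.Place.Completion (Sum.inr ((Rat.HeightOneSpectrum.primesEquiv (R := 𝓞 ℚ)).symm ⟨p, Fact.out⟩) : NumberField.Place ℚ))) < 1 from LocalField.valuation_adicCompletion_natCast_lt_one ((Rat.HeightOneSpectrum.primesEquiv (R := 𝓞 ℚ)).symm ⟨p, Fact.out⟩) p ((natCast_mem_asIdeal_iff_eq_primesEquiv_symm _ (Fact.out : p.Prime)).mpr rfl))⟩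
    haveI := isAdicComplete_integerC_natCast (show valuation (NumberField.Place.Completion (Sum.inr ((Rat.HeightOneSpectrum.primesEquiv (R := 𝓞 ℚ)).symm ⟨p, Fact.out⟩) : NumberField.Place ℚ)) ((p : ℕ) : (NumberField.Place.Completion (Sum.inr ((Rat.HeightOneSpectrum.primesEquiv (R := 𝓞 ℚ)).symm ⟨p, Fact.out⟩) : NumberField.Place ℚ))) < 1 from LocalField.valuation_adicCompletion_natCast_lt_one ((Rat.HeightOneSpectrum.primesEquiv (R := 𝓞 ℚ)).symm ⟨p, Fact.out⟩) p ((natCast_mem_asIdeal_iff_eq_primesEquiv_symm _ (Fact.out : p.Prime)).mpr rfl))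
    -- the tree's `ℚ`-algebra structure on `ℚ_v` (the one `DefinedExpStarBody`'s restricted representations are built on) pinned as the
    -- most recent local instance (as in `AdmissibleZetaClassBody`), so that it — and not `DivisionRing.toRatAlgebra` — is synthesized
    letI : Algebra ℚ (NumberField.Place.Completion (Sum.inr ((Rat.HeightOneSpectrum.primesEquiv (R := 𝓞 ℚ)).symm ⟨p, Fact.out⟩) : NumberField.Place ℚ)) :=
      NumberField.Place.instAlgebraCompletion (Sum.inr ((Rat.HeightOneSpectrum.primesEquiv (R := 𝓞 ℚ)).symm ⟨p, Fact.out⟩) : NumberField.Place ℚ)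
    letI ρT := restrictedTateRep W (NumberField.Place.Completion (Sum.inr ((Rat.HeightOneSpectrum.primesEquiv (R := 𝓞 ℚ)).symm ⟨p, Fact.out⟩) : NumberField.Place ℚ)) p
    letI ρT₂ := restrictedTateRep W₂ (NumberField.Place.Completion (Sum.inr ((Rat.HeightOneSpectrum.primesEquiv (R := 𝓞 ℚ)).symm ⟨p, Fact.out⟩) : NumberField.Place ℚ)) p
    ∀ (d : (bdRPeriodRingData (F := (NumberField.Place.Completion (Sum.inr ((Rat.HeightOneSpectrum.primesEquiv (R := 𝓞 ℚ)).symm ⟨p, Fact.out⟩) : NumberField.Place ℚ))) (p := p) (show valuation (NumberField.Place.Completion (Sum.inr ((Rat.HeightOneSpectrum.primesEquiv (R := 𝓞 ℚ)).symm ⟨p, Fact.out⟩) : NumberField.Place ℚ)) ((p : ℕ) : (NumberField.Place.Completion (Sum.inr ((Rat.HeightOneSpectrum.primesEquiv (R := 𝓞 ℚ)).symm ⟨p, Fact.out⟩) : NumberField.Place ℚ))) < 1 from LocalField.valuation_adicCompletion_natCast_lt_one ((Rat.HeightOneSpectrum.primesEquiv (R := 𝓞 ℚ)).symm ⟨p,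 Fact.out⟩) p ((natCast_mem_asIdeal_iff_eq_primesEquiv_symm _ (Fact.out : p.Prime)).mpr rfl))).FilZeroLine (restrictedRationalTateRep W (NumberField.Place.Completion (Sum.inr ((Rat.HeightOneSpectrum.primesEquiv (R := 𝓞 ℚ)).symm ⟨p, Fact.out⟩) : NumberField.Place ℚ)) p))
      (d₂ : (bdRPeriodRingData (F := (NumberField.Place.Completion (Sum.inr ((Rat.HeightOneSpectrum.primesEquiv (R := 𝓞 ℚ)).symm ⟨p, Fact.out⟩) : NumberField.Place ℚ))) (p := p) (show valuation (NumberField.Place.Completion (Sum.inr ((Rat.HeightOneSpectrum.primesEquiv (R := 𝓞 ℚ)).symm ⟨p, Fact.out⟩) : NumberField.Place ℚ)) ((p : ℕ) : (NumberField.Place.Completion (Sum.inr ((Rat.HeightOneSpectrum.primesEquiv (R := 𝓞 ℚ)).symm ⟨p, Fact.out⟩) : NumberField.Place ℚ))) < 1 from LocalField.valuation_adicCompletion_natCast_lt_one ((Rat.HeightOneSpectrum.primesEquiv (R := 𝓞 ℚ)).symm ⟨p, Fact.out⟩) p ((natCast_mem_asIdeal_iff_eq_primesEquiv_symm _ (Fact.out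 : p.Prime)).mpr rfl))).FilZeroLine (restrictedRationalTateRep W₂ (NumberField.Place.Completion (Sum.inr ((Rat.HeightOneSpectrum.primesEquiv (R := 𝓞 ℚ)).symm ⟨p, Fact.out⟩) : NumberField.Place ℚ)) p)),
    -- conclusion (i) of `definedExpStarBody_isogeny_transport` for `(d, d₂)`, VERBATIM
    (∀ (η : contOneCocycles ρT₂.toTopRep) (η' : contOneCocycles ρT.toTopRep),
        (∀ σ, η'.1 σ = TateModule.map p α.toAddMonoidHom (η.1 σ)) →
        expStarCoord W₂ (show valuation (NumberField.Place.Completion (Sum.inr ((Rat.HeightOneSpectrum.primesEquiv (R := 𝓞 ℚ)).symm ⟨p, Fact.out⟩) : NumberField.Place ℚ)) ((p : ℕ) : (NumberField.Place.Completion (Sum.inr ((Rat.HeightOneSpectrum.primesEquiv (R := 𝓞 ℚ)).symm ⟨p, Fact.out⟩) : NumberField.Place ℚ))) < 1 from LocalField.valuation_adicCompletion_natCast_lt_one ((Rat.HeightOneSpectrum.primesEquiv (R := 𝓞 ℚ)).symm ⟨p, Fact.out⟩) p ((natCast_mem_asIdeal_iff_eq_primesEquiv_symm _ (Fact.out : p.Prime)).mpr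 rfl)) d₂ η =
          (show (NumberField.Place.Completion (Sum.inr ((Rat.HeightOneSpectrum.primesEquiv (R := 𝓞 ℚ)).symm ⟨p, Fact.out⟩) : NumberField.Place ℚ)) from (Padic.adicCompletionEquiv (𝓞 ℚ) ⟨p, Fact.out⟩ (e : ℚ_[p])))⁻¹ * expStarCoord W (show valuation (NumberField.Place.Completion (Sum.inr ((Rat.HeightOneSpectrum.primesEquiv (R := 𝓞 ℚ)).symm ⟨p, Fact.out⟩) : NumberField.Place ℚ)) ((p : ℕ) : (NumberField.Place.Completion (Sum.inr ((Rat.HeightOneSpectrum.primesEquiv (R := 𝓞 ℚ)).symm ⟨p, Fact.out⟩) : NumberField.Place ℚ))) < 1 from LocalField.valuation_adicCompletion_natCast_lt_one ((Rat.HeightOneSpectrum.primesEquiv (R := 𝓞 ℚ)).symm ⟨p, Fact.out⟩) p ((natCast_mem_asIdeal_iff_eq_primesEquiv_symm _ (Fact.out : p.Prime)).mpr rfl)) d η') →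
    -- (A2) at `(W, d)`: the clause of `CM.kato15161_ellipticUnitClass_res_zetaFamily_exact` l.263–267, VERBATIM
    (∀ a : (NumberField.Place.Completion (Sum.inr ((Rat.HeightOneSpectrum.primesEquiv (R := 𝓞 ℚ)).symm ⟨p, Fact.out⟩) : NumberField.Place ℚ)),
        (∃ η : contOneCocycles ρT.toTopRep, expStarCoord W (show valuation (NumberField.Place.Completion (Sum.inr ((Rat.HeightOneSpectrum.primesEquiv (R := 𝓞 ℚ)).symm ⟨p, Fact.out⟩) : NumberField.Place ℚ)) ((p : ℕ) : (NumberField.Place.Completion (Sum.inr ((Rat.HeightOneSpectrum.primesEquiv (R := 𝓞 ℚ)).symm ⟨p, Fact.out⟩) : NumberField.Place ℚ))) < 1 from LocalField.valuation_adicCompletion_natCast_lt_one ((Rat.HeightOneSpectrum.primesEquiv (R := 𝓞 ℚ)).symm ⟨p, Fact.out⟩) p ((natCast_mem_asIdeal_iff_eq_primesEquiv_symm _ (Fact.out : p.Prime)).mpr rfl)) d η = a) ↔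
          ∀ Q : (W.baseChange ℚ_[p]).toAffine.Point,
            ‖(Padic.adicCompletionEquiv (𝓞 ℚ) ⟨p, Fact.out⟩).symm
                (show ((Rat.HeightOneSpectrum.primesEquiv (R := 𝓞 ℚ)).symm ⟨p, Fact.out⟩).adicCompletion ℚ from a) * padicLogLocal W p Q‖ ≤ 1) →
    -- (A2) at `(W₂, d₂)`: the same clause read with `W ↦ W₂`, `d ↦ d₂`, `ρT ↦ ρT₂`
    ∀ a : (NumberField.Place.Completion (Sum.inr ((Rat.HeightOneSpectrum.primesEquiv (R := 𝓞 ℚ)).symm ⟨p, Fact.out⟩) : NumberField.Place ℚ)),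
      (∃ η : contOneCocycles ρT₂.toTopRep, expStarCoord W₂ (show valuation (NumberField.Place.Completion (Sum.inr ((Rat.HeightOneSpectrum.primesEquiv (R := 𝓞 ℚ)).symm ⟨p, Fact.out⟩) : NumberField.Place ℚ)) ((p : ℕ) : (NumberField.Place.Completion (Sum.inr ((Rat.HeightOneSpectrum.primesEquiv (R := 𝓞 ℚ)).symm ⟨p, Fact.out⟩) : NumberField.Place ℚ))) < 1 from LocalField.valuation_adicCompletion_natCast_lt_one ((Rat.HeightOneSpectrum.primesEquiv (R := 𝓞 ℚ)).symm ⟨p, Fact.out⟩) p ((natCast_mem_asIdeal_iff_eq_primesEquiv_symm _ (Fact.out : p.Prime)).mpr rfl)) d₂ η = a) ↔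
        ∀ Q : (W₂.baseChange ℚ_[p]).toAffine.Point,
          ‖(Padic.adicCompletionEquiv (𝓞 ℚ) ⟨p, Fact.out⟩).symm
                (show ((Rat.HeightOneSpectrum.primesEquiv (R := 𝓞 ℚ)).symm ⟨p, Fact.out⟩).adicCompletion ℚ from a) * padicLogLocal W₂ p Q‖ ≤ 1 := by
  letI : ValuativeRel (NumberField.Place.Completion (Sum.inr ((Rat.HeightOneSpectrum.primesEquiv (R := 𝓞 ℚ)).symm ⟨p, Fact.out⟩) : NumberField.Place ℚ)) :=
    inferInstanceAs (ValuativeRel (((Rat.HeightOneSpectrum.primesEquiv (R := 𝓞 ℚ)).symm ⟨p, Fact.out⟩).adicCompletion ℚ))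
  letI : TopologicalSpace (NumberField.Place.Completion (Sum.inr ((Rat.HeightOneSpectrum.primesEquiv (R := 𝓞 ℚ)).symm ⟨p, Fact.out⟩) : NumberField.Place ℚ)) :=
    inferInstanceAs (TopologicalSpace (((Rat.HeightOneSpectrum.primesEquiv (R := 𝓞 ℚ)).symm ⟨p, Fact.out⟩).adicCompletion ℚ))
  haveI : IsNonarchimedeanLocalField (NumberField.Place.Completion (Sum.inr ((Rat.HeightOneSpectrum.primesEquiv (R := 𝓞 ℚ)).symm ⟨p, Fact.out⟩) : NumberField.Place ℚ)) :=
    inferInstanceAs (IsNonarchimedeanLocalField (((Rat.HeightOneSpectrum.primesEquiv (R := 𝓞 ℚ)).symm ⟨p, Fact.out⟩).adicCompletion ℚ))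
  haveI : CharZero (NumberField.Place.Completion (Sum.inr ((Rat.HeightOneSpectrum.primesEquiv (R := 𝓞 ℚ)).symm ⟨p, Fact.out⟩) : NumberField.Place ℚ)) := LocalField.charZero_adicCompletion ((Rat.HeightOneSpectrum.primesEquiv (R := 𝓞 ℚ)).symm ⟨p, Fact.out⟩)
  letI : Algebra ℚ_[p] (NumberField.Place.Completion (Sum.inr ((Rat.HeightOneSpectrum.primesEquiv (R := 𝓞 ℚ)).symm ⟨p, Fact.out⟩) : NumberField.Place ℚ)) :=
    LocalField.adicCompletionPadicAlgebra ((Rat.HeightOneSpectrum.primesEquiv (R := 𝓞 ℚ)).symm ⟨p, Fact.out⟩) p ((natCast_mem_asIdeal_iff_eq_primesEquiv_symm _ (Fact.out : p.Prime)).mpr rfl)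
  haveI : Fact (¬ IsUnit ((p : ℕ) : integerC (NumberField.Place.Completion (Sum.inr ((Rat.HeightOneSpectrum.primesEquiv (R := 𝓞 ℚ)).symm ⟨p, Fact.out⟩) : NumberField.Place ℚ)))) :=
    ⟨not_isUnit_natCast_integerC (show valuation (NumberField.Place.Completion (Sum.inr ((Rat.HeightOneSpectrum.primesEquiv (R := 𝓞 ℚ)).symm ⟨p, Fact.out⟩) : NumberField.Place ℚ)) ((p : ℕ) : (NumberField.Place.Completion (Sum.inr ((Rat.HeightOneSpectrum.primesEquiv (R := 𝓞 ℚ)).symm ⟨p, Fact.out⟩) : NumberField.Place ℚ))) < 1 from LocalField.valuation_adicCompletion_natCast_lt_one ((Rat.HeightOneSpectrum.primesEquiv (R := 𝓞 ℚ)).symm ⟨p, Fact.out⟩) p ((natCast_mem_asIdeal_iff_eq_primesEquiv_symm _ (Fact.out : p.Prime)).mpr rfl))⟩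
  haveI := isAdicComplete_integerC_natCast (show valuation (NumberField.Place.Completion (Sum.inr ((Rat.HeightOneSpectrum.primesEquiv (R := 𝓞 ℚ)).symm ⟨p, Fact.out⟩) : NumberField.Place ℚ)) ((p : ℕ) : (NumberField.Place.Completion (Sum.inr ((Rat.HeightOneSpectrum.primesEquiv (R := 𝓞 ℚ)).symm ⟨p, Fact.out⟩) : NumberField.Place ℚ))) < 1 from LocalField.valuation_adicCompletion_natCast_lt_one ((Rat.HeightOneSpectrum.primesEquiv (R := 𝓞 ℚ)).symm ⟨p, Fact.out⟩) p ((natCast_mem_asIdeal_iff_eq_primesEquiv_symm _ (Fact.out : p.Prime)).mpr rfl))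
  letI : Algebra ℚ (NumberField.Place.Completion (Sum.inr ((Rat.HeightOneSpectrum.primesEquiv (R := 𝓞 ℚ)).symm ⟨p, Fact.out⟩) : NumberField.Place ℚ)) :=
    NumberField.Place.instAlgebraCompletion (Sum.inr ((Rat.HeightOneSpectrum.primesEquiv (R := 𝓞 ℚ)).symm ⟨p, Fact.out⟩) : NumberField.Place ℚ)
  intro d d₂ hi hA2 a
  -- `e ≠ 0` in `ℚ_p`, `e` read in `ℚ_v` is non-zero, `|e|_p = 1`, `e ∈ ℤ_pˣ`
  have he0 : e ≠ 0 := by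
    rintro rfl
    exact hpe (dvd_zero _)
  have hep : ((e : ℤ) : ℚ_[p]) ≠ 0 := Int.cast_ne_zero.mpr he0
  have hcV : (show (NumberField.Place.Completion (Sum.inr ((Rat.HeightOneSpectrum.primesEquiv (R := 𝓞 ℚ)).symm ⟨p, Fact.out⟩) : NumberField.Place ℚ)) from (Padic.adicCompletionEquiv (𝓞 ℚ) ⟨p, Fact.out⟩ (e : ℚ_[p]))) ≠ 0 :=
    (_root_.map_ne_zero (Padic.adicCompletionEquiv (𝓞 ℚ) ⟨p, Fact.out⟩)).mpr hep
  have hnorm : ‖((e : ℤ) : ℚ_[p])‖ = 1 :=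
    le_antisymm (Padic.norm_int_le_one e)
      (not_lt.mp fun hlt => hpe (Padic.norm_intCast_lt_one_iff.mp hlt))
  have hu : IsUnit ((e : ℤ) : ℤ_[p]) := by
    rw [PadicInt.isUnit_iff]
    exact le_antisymm (PadicInt.norm_le_one _)
      (not_lt.mp fun hlt => hpe ((PadicInt.norm_int_lt_one_iff_dvd e).mp hlt))
  -- reading `e · a` in `ℚ_p`: `E⁻¹(E(e) · a) = e · E⁻¹(a)`, and `‖e · x‖ = ‖x‖`
  have hsymm : (Padic.adicCompletionEquiv (𝓞 ℚ) ⟨p, Fact.out⟩).symm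
                (show ((Rat.HeightOneSpectrum.primesEquiv (R := 𝓞 ℚ)).symm ⟨p, Fact.out⟩).adicCompletion ℚ from (show (NumberField.Place.Completion (Sum.inr ((Rat.HeightOneSpectrum.primesEquiv (R := 𝓞 ℚ)).symm ⟨p, Fact.out⟩) : NumberField.Place ℚ)) from (Padic.adicCompletionEquiv (𝓞 ℚ) ⟨p, Fact.out⟩ (e : ℚ_[p]))) * a) =
      ((e : ℤ) : ℚ_[p]) * (Padic.adicCompletionEquiv (𝓞 ℚ) ⟨p, Fact.out⟩).symm
                (show ((Rat.HeightOneSpectrum.primesEquiv (R := 𝓞 ℚ)).symm ⟨p, Fact.out⟩).adicCompletion ℚ from a) := by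
    rw [map_mul, ContinuousAlgEquiv.symm_apply_apply]
  have hiff : (∀ Q : (W.baseChange ℚ_[p]).toAffine.Point,
        ‖(Padic.adicCompletionEquiv (𝓞 ℚ) ⟨p, Fact.out⟩).symm
                (show ((Rat.HeightOneSpectrum.primesEquiv (R := 𝓞 ℚ)).symm ⟨p, Fact.out⟩).adicCompletion ℚ from (show (NumberField.Place.Completion (Sum.inr ((Rat.HeightOneSpectrum.primesEquiv (R := 𝓞 ℚ)).symm ⟨p, Fact.out⟩) : NumberField.Place ℚ)) from (Padic.adicCompletionEquiv (𝓞 ℚ) ⟨p, Fact.out⟩ (e : ℚ_[p]))) * a) * padicLogLocal W p Q‖ ≤ 1) ↔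
      ∀ Q : (W.baseChange ℚ_[p]).toAffine.Point,
        ‖(Padic.adicCompletionEquiv (𝓞 ℚ) ⟨p, Fact.out⟩).symm
                (show ((Rat.HeightOneSpectrum.primesEquiv (R := 𝓞 ℚ)).symm ⟨p, Fact.out⟩).adicCompletion ℚ from a) * padicLogLocal W p Q‖ ≤ 1 := by
    refine forall_congr' fun Q => ?_
    rw [hsymm, mul_assoc, norm_mul, hnorm, one_mul]
  -- (T-A2)′ for the pair `(β, α)`: the two dual log-lattices coincide
  have hTW := hT W W₂ β α e hαβ hβα p hpe
    ((Padic.adicCompletionEquiv (𝓞 ℚ) ⟨p, Fact.out⟩).symm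
                (show ((Rat.HeightOneSpectrum.primesEquiv (R := 𝓞 ℚ)).symm ⟨p, Fact.out⟩).adicCompletion ℚ from a))
  -- push-forward of cocycles by `T_pα` (`W₂ → W`) and by `e⁻¹ · T_pβ` (`W → W₂`), the inverse of `T_pα`
  let pushV : contOneCocycles (restrictedTateRep W₂ (NumberField.Place.Completion (Sum.inr ((Rat.HeightOneSpectrum.primesEquiv (R := 𝓞 ℚ)).symm ⟨p, Fact.out⟩) : NumberField.Place ℚ)) p).toTopRep →+ contOneCocycles (restrictedTateRep W (NumberField.Place.Completion (Sum.inr ((Rat.HeightOneSpectrum.primesEquiv (R := 𝓞 ℚ)).symm ⟨p, Fact.out⟩) : NumberField.Place ℚ)) p).toTopRep :=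
    contOneCocycles.pushAddHom (TateModule.map p α.toAddMonoidHom).toAddMonoidHom (continuous_tateModule_map p α.toAddMonoidHom)
      (fun σ x => Literature.AlgebraicGeometry.Motives.tateModule_map_smul p α _ x)
  have hpushV : ∀ η σ, (pushV η).1 σ = TateModule.map p α.toAddMonoidHom (η.1 σ) := fun _ _ => rfl
  have hequiv : ∀ (σ : absoluteGaloisGroup ℚ) (x : W.tateModule p),
      ((↑hu.unit⁻¹ : ℤ_[p]) • TateModule.map p β.toAddMonoidHom) (σ • x) =
        σ • (((↑hu.unit⁻¹ : ℤ_[p]) • TateModule.map p β.toAddMonoidHom) x) := fun σ x => by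
    rw [LinearMap.smul_apply, LinearMap.smul_apply, Literature.AlgebraicGeometry.Motives.tateModule_map_smul p β σ x]
    exact ((W₂.galoisRepTate p σ).map_smul (↑hu.unit⁻¹ : ℤ_[p]) (TateModule.map p β.toAddMonoidHom x)).symm
  let pushInv : contOneCocycles (restrictedTateRep W (NumberField.Place.Completion (Sum.inr ((Rat.HeightOneSpectrum.primesEquiv (R := 𝓞 ℚ)).symm ⟨p, Fact.out⟩) : NumberField.Place ℚ)) p).toTopRep →+ contOneCocycles (restrictedTateRep W₂ (NumberField.Place.Completion (Sum.inr ((Rat.HeightOneSpectrum.primesEquiv (R := 𝓞 ℚ)).symm ⟨p, Fact.out⟩) : NumberField.Place ℚ)) p).toTopRep :=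
    contOneCocycles.pushAddHom ((↑hu.unit⁻¹ : ℤ_[p]) • TateModule.map p β.toAddMonoidHom).toAddMonoidHom
      ((continuous_tateModule_map p β.toAddMonoidHom).const_smul (↑hu.unit⁻¹ : ℤ_[p]))
      (fun σ x => hequiv _ x)
  have hpushInv : ∀ η σ, (pushInv η).1 σ = (↑hu.unit⁻¹ : ℤ_[p]) • TateModule.map p β.toAddMonoidHom (η.1 σ) := fun _ _ => rfl
  -- `T_pα ∘ T_pβ = e`, so `T_pα ∘ (e⁻¹ · T_pβ) = id`
  have hαβT : ∀ y : W.tateModule p,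
      TateModule.map p α.toAddMonoidHom (TateModule.map p β.toAddMonoidHom y) = ((e : ℤ) : ℤ_[p]) • y := fun y => by
    rw [Int.cast_smul_eq_zsmul]
    refine TateModule.ext fun k => ?_
    rw [TateModule.proj_map, TateModule.proj_map, map_zsmul]
    exact hαβ _
  have hαinv : ∀ y : W.tateModule p,
      TateModule.map p α.toAddMonoidHom ((↑hu.unit⁻¹ : ℤ_[p]) • TateModule.map p β.toAddMonoidHom y) = y := fun y => by
    rw [map_smul, hαβT, smul_smul, IsUnit.val_inv_mul, one_smul]
  constructor
  · -- `⊆`: `exp*_{d₂}(η₂) = a` ⇒ `exp*_d(α_* η₂) = e · a` ⇒ `e · a ∈ 𝓛_W^∨` ⇒ `a ∈ 𝓛_W^∨ = 𝓛_{W₂}^∨`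
    rintro ⟨η₂, hη₂⟩
    have h1 : expStarCoord W (show valuation (NumberField.Place.Completion (Sum.inr ((Rat.HeightOneSpectrum.primesEquiv (R := 𝓞 ℚ)).symm ⟨p, Fact.out⟩) : NumberField.Place ℚ)) ((p : ℕ) : (NumberField.Place.Completion (Sum.inr ((Rat.HeightOneSpectrum.primesEquiv (R := 𝓞 ℚ)).symm ⟨p, Fact.out⟩) : NumberField.Place ℚ))) < 1 from LocalField.valuation_adicCompletion_natCast_lt_one ((Rat.HeightOneSpectrum.primesEquiv (R := 𝓞 ℚ)).symm ⟨p, Fact.out⟩) p ((natCast_mem_asIdeal_iff_eq_primesEquiv_symm _ (Fact.out : p.Prime)).mpr rfl)) d (pushV η₂) = (show (NumberField.Place.Completion (Sum.inr ((Rat.HeightOneSpectrum.primesEquiv (R := 𝓞 ℚ)).symm ⟨p, Fact.out⟩) : NumberField.Place ℚ)) from (Padic.adicCompletionEquiv (𝓞 ℚ) ⟨p, Fact.out⟩ (e : ℚ_[p]))) * a := by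
      rw [← hη₂, hi η₂ (pushV η₂) (fun σ => hpushV η₂ σ), mul_inv_cancel_left₀ hcV]
    exact hTW.mp (hiff.mp ((hA2 _).mp ⟨pushV η₂, h1⟩))
  · -- `⊇`: `a ∈ 𝓛_{W₂}^∨ = 𝓛_W^∨` ⇒ `exp*_d(η) = e · a` ⇒ `η₂ := (e⁻¹ · T_pβ)_* η`, `α_* η₂ = η`, `exp*_{d₂}(η₂) = e⁻¹ · e · a = a`
    intro hQ₂
    obtain ⟨η, hη⟩ := (hA2 _).mpr (hiff.mpr (hTW.mpr hQ₂))
    refine ⟨pushInv η, ?_⟩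
    rw [hi (pushInv η) η (fun σ => by rw [hpushInv, hαinv]), hη, inv_mul_cancel_left₀ hcV]

end Transport

end Literature.NumberTheory.EllipticCurves.Kato2004

end
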